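/-
Origin: written from primary sources — J.-P. Serre, *Linear Representations of Finite Groups*
(GTM 42, 1977) §13.2 (Prop. 38–39: for an irreducible representation over an algebraically closed
field the space of invariant bilinear forms has dimension ≤ 1, and a non-zero invariant form is
either symmetric or alternating, never both); W. Fulton, J. Harris, *Representation Theory*
(GTM 129, 1991) §3.5 and Exercise 3.38 (Frobenius–Schur). Adapted: no. Kernel only, Mathlib's
`Representation.IsIrreducible` / `IntertwiningMap` Schur lemma
(`Representation.IsIrreducible.algebraMap_intertwiningMap_bijective_of_isAlgClosed`).
-/
import Mathlib.RepresentationTheory.Irreducible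
import Mathlib.LinearAlgebra.BilinearForm.Properties
import Mathlib.LinearAlgebra.Determinant
import HarnessLib

/-!
# Invariant bilinear forms on an irreducible representation: uniqueness up to a scalar, and the
# symmetric/alternating exclusion (Frobenius–Schur)

Setting: a group `G`, an algebraically closed field `k`, a finite-dimensional irreducible
representation `ρ : Representation k G V` (Mathlib's `Representation.IsIrreducible`). A bilinear
form `B : V →ₗ[k] V →ₗ[k] k` is *invariant* when `B (ρ g x) (ρ g y) = B x y` for all `g, x, y`
(stated pointwise as a hypothesis; no predicate is introduced).

* `exists_eq_smul_of_invariant` — if `ω` is a NON-DEGENERATE invariant form then every invariant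
  form is `c • ω` for some `c : k` (Serre §13.2: the invariant forms are the intertwining maps
  `V → V*`, and `Hom_G(V, V) = k` by Schur; proof: `T = ω⁻¹ ∘ B` intertwines `ρ` with itself).
* `eq_zero_of_isSymm_of_isAlt_invariant` — in characteristic `≠ 2`, if `ρ` carries a
  non-degenerate invariant ALTERNATING form (symplectic type) then every invariant SYMMETRIC form
  is `0`, i.e. `(Sym² V^*)^G = 0`; `eq_zero_of_isAlt_of_isSymm_invariant` — symmetrically, an
  orthogonal-type `ρ` has no non-zero invariant alternating form (Serre Prop. 39 / Fulton–Harris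
  Ex. 3.38: the Frobenius–Schur types are mutually exclusive).
* `eq_zero_of_isSymm_invariant_of_det_eq_one` — **dimension 2**: if `dim V = 2` and
  `det ρ(g) = 1` for all `g`, the determinant form `(x, y) ↦ det_b(x, y)` is a non-degenerate
  invariant alternating form, so `ρ` admits NO non-zero invariant symmetric bilinear form.

Why this is filed (Goldfeld census, rh-explicit cell, row c2:G-FUN-14): in Goldfeld's
amplification (Ann. Sc. Norm. Sup. Pisa 1976, Thm 1 rider; Astérisque 41–42 (1977) §5, p. 224)
the exponent is `g − μ − ρ` with `ρ = ord_{s=1} ∏_p (1 − α_p² p^{−s})^{−1}(1 − β_p² p^{−s})^{−1}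
= ord L(Sym², s) − ord L(det, s)`; Goldfeld asks (1977, p. 224) for «examples of L-functions for
which g − ρ ≥ 2 and ρ < 1». For a two-dimensional irreducible object with trivial determinant — the
only case in which the sign of the functional equation can be `−1` and force `g ≥ 1` — `ρ < 1`
would need a pole of `L(Sym², s)` at the edge, i.e. a non-zero `G`-invariant in `Sym²`, i.e. a
non-zero invariant symmetric bilinear form on the (self-dual) representation; the dimension-2
theorem says there is none. So in degree 2 «forced central zero» (symplectic) and «ρ < 1»
(orthogonal) exclude each other, which is the structural reason the 1977 wish has no example.
Everything is kernel-proved, `[folklore]`/textbook; no definition, no named fact.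

## References

* [SerreLinearRepresentations1977] J.-P. Serre, *Linear Representations of Finite Groups*,
  GTM 42, Springer 1977, §13.2, Prop. 38–39.
* [FultonHarrisGTM129] W. Fulton, J. Harris, *Representation Theory. A First Course*, GTM 129,
  Springer 1991, §3.5, Exercise 3.38.
* [Goldfeld1977] D. Goldfeld, *The conjectures of Birch and Swinnerton-Dyer and the class numbers
  of quadratic fields*, Astérisque 41–42 (1977) 219–227, §5 (p. 224).
-/

namespace Literature.RepresentationTheory

open Module

variable {k G V : Type*} [Field k] [Group G] [AddCommGroup V] [Module k V]

/-! ### Uniqueness of the invariant form up to a scalar (Schur) -/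

/-- **Invariant bilinear forms on an irreducible representation are proportional** (Serre,
*Linear Representations*, §13.2, proof of Prop. 38: an invariant form is a `G`-map `V → V*`, and
`dim Hom_G = 1` by Schur's lemma over an algebraically closed field). Let `ρ` be a
finite-dimensional irreducible representation of a group `G` over an algebraically closed field
`k`, `ω` a non-degenerate invariant bilinear form and `B` any invariant bilinear form. Then
`B = c • ω` for some `c : k`. Proof: `T := ω♭⁻¹ ∘ B♭ : V → V` satisfies `ω (T x) y = B x y`,
intertwines `ρ` (invariance of both forms and non-degeneracy of `ω`), hence is a scalar `c` by
`Representation.IsIrreducible.algebraMap_intertwiningMap_bijective_of_isAlgClosed`.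
[cite: SerreLinearRepresentations1977, §13.2 Prop. 38] -/
theorem exists_eq_smul_of_invariant [FiniteDimensional k V] [IsAlgClosed k]
    (ρ : Representation k G V) [ρ.IsIrreducible] {ω B : LinearMap.BilinForm k V}
    (hωG : ∀ g x y, ω (ρ g x) (ρ g y) = ω x y) (hω : ω.Nondegenerate)
    (hBG : ∀ g x y, B (ρ g x) (ρ g y) = B x y) : ∃ c : k, B = c • ω := by
  -- `T = ω⁻¹ ∘ B`, characterised by `ω (T x) y = B x y`
  let T : V →ₗ[k] V := (ω.toDual hω).symm.toLinearMap ∘ₗ B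
  have hT : ∀ x y, ω (T x) y = B x y := fun x y ↦ by
    simp only [T, LinearMap.coe_comp, LinearEquiv.coe_coe, Function.comp_apply,
      LinearMap.BilinForm.apply_toDual_symm_apply]
  -- `T` intertwines `ρ` with itself
  have hTG : ∀ (g : G) (x : V), T (ρ g x) = ρ g (T x) := by
    intro g x
    have hzero : ∀ y, ω (T (ρ g x) - ρ g (T x)) y = 0 := fun y ↦ by
      have hy : y = ρ g (ρ g⁻¹ y) := by
        rw [← Module.End.mul_apply, ← map_mul, mul_inv_cancel, map_one, Module.End.one_apply]
      rw [map_sub, LinearMap.sub_apply, hT, sub_eq_zero, hy, hBG, hωG, hT]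
    exact sub_eq_zero.mp (hω.1 _ hzero)
  -- Schur: `T = c • id`
  obtain ⟨c, hc⟩ :=
    (Representation.IsIrreducible.algebraMap_intertwiningMap_bijective_of_isAlgClosed (ρ := ρ)).2
      (LinearMap.intertwiningMap_of_isIntertwiningMap ρ ρ T hTG)
  have hTc : ∀ x, T x = c • x := fun x ↦ by
    have h := congrArg (fun f : Representation.IntertwiningMap ρ ρ ↦ f x) hc
    simp only [Representation.IntertwiningMap.algebraMap_apply,
      Representation.IntertwiningMap.smul_apply, Representation.IntertwiningMap.coe_one,
      id_eq] at h
    -- `h : c • x = (intertwiningMap_of … T) x`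
    rw [h]
    rfl
  refine ⟨c, ?_⟩
  ext x y
  rw [← hT, hTc]
  simp only [map_smul, LinearMap.smul_apply, smul_eq_mul]

/-! ### Symmetric versus alternating (Frobenius–Schur exclusion) -/

/-- In characteristic `≠ 2`, a bilinear form proportional to an alternating form and symmetric
is zero: `B = c • ω`, `ω` alternating, `B` symmetric `⇒ B = 0` (`B x y = c ω x y = −c ω y x
= −B y x = −B x y`). [folklore] -/
private theorem eq_zero_of_isSymm_of_eq_smul_isAlt (h2 : (2 : k) ≠ 0) {ω B : LinearMap.BilinForm k V}
    (hωalt : ω.IsAlt) (hB : B.IsSymm) {c : k} (hc : B = c • ω) : B = 0 := by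
  ext x y
  have h1 : B x y = c * ω x y := by rw [hc]; rfl
  have h2' : B y x = c * ω y x := by rw [hc]; rfl
  have hs : B x y = B y x := hB.eq x y
  have ha : ω y x = -ω x y := (hωalt.neg_eq x y).symm
  have : 2 * B x y = 0 := by
    rw [two_mul]
    nth_rewrite 2 [hs]
    rw [h1, h2', ha]
    ring
  rcases mul_eq_zero.mp this with h | h
  · exact absurd h h2
  · simpa using h

/-- In characteristic `≠ 2`, a bilinear form proportional to a symmetric form and alternating is
zero: `B = c • ω`, `ω` symmetric, `B` alternating `⇒ B = 0`. [folklore] -/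
private theorem eq_zero_of_isAlt_of_eq_smul_isSymm (h2 : (2 : k) ≠ 0) {ω B : LinearMap.BilinForm k V}
    (hωsymm : ω.IsSymm) (hB : B.IsAlt) {c : k} (hc : B = c • ω) : B = 0 := by
  ext x y
  have h1 : B x y = c * ω x y := by rw [hc]; rfl
  have h2' : B y x = c * ω y x := by rw [hc]; rfl
  have hs : ω x y = ω y x := hωsymm.eq x y
  have ha : B y x = -B x y := (hB.neg_eq x y).symm
  have : 2 * B x y = 0 := by
    have : B x y = B y x := by rw [h1, h2', hs]
    rw [ha] at this
    linear_combination this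
  rcases mul_eq_zero.mp this with h | h
  · exact absurd h h2
  · simpa using h

/-- **A symplectic irreducible representation carries no invariant symmetric form**
(Frobenius–Schur exclusion; Serre §13.2 Prop. 39, Fulton–Harris Ex. 3.38). Let `ρ` be a
finite-dimensional irreducible representation of a group `G` over an algebraically closed field
`k` of characteristic `≠ 2`, and `ω` a non-degenerate invariant ALTERNATING bilinear form on `V`.
Then every invariant SYMMETRIC bilinear form `B` on `V` is zero — `(Sym² V^*)^G = 0`.
[cite: SerreLinearRepresentations1977, §13.2 Prop. 38–39] [cite: FultonHarrisGTM129, §3.5 Ex. 3.38] -/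
theorem eq_zero_of_isSymm_of_isAlt_invariant [FiniteDimensional k V] [IsAlgClosed k]
    (h2 : (2 : k) ≠ 0) (ρ : Representation k G V) [ρ.IsIrreducible]
    {ω B : LinearMap.BilinForm k V} (hωG : ∀ g x y, ω (ρ g x) (ρ g y) = ω x y)
    (hω : ω.Nondegenerate) (hωalt : ω.IsAlt) (hBG : ∀ g x y, B (ρ g x) (ρ g y) = B x y)
    (hB : B.IsSymm) : B = 0 := by
  obtain ⟨c, hc⟩ := exists_eq_smul_of_invariant ρ hωG hω hBG
  exact eq_zero_of_isSymm_of_eq_smul_isAlt h2 hωalt hB hc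

/-- **An orthogonal irreducible representation carries no invariant alternating form** (the
other half of the Frobenius–Schur exclusion; Serre §13.2 Prop. 39). With `ρ` as above and `ω` a
non-degenerate invariant SYMMETRIC bilinear form, every invariant ALTERNATING bilinear form `B` is
zero — `(Λ² V^*)^G = 0`. [cite: SerreLinearRepresentations1977, §13.2 Prop. 38–39] -/
theorem eq_zero_of_isAlt_of_isSymm_invariant [FiniteDimensional k V] [IsAlgClosed k]
    (h2 : (2 : k) ≠ 0) (ρ : Representation k G V) [ρ.IsIrreducible]
    {ω B : LinearMap.BilinForm k V} (hωG : ∀ g x y, ω (ρ g x) (ρ g y) = ω x y)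
    (hω : ω.Nondegenerate) (hωsymm : ω.IsSymm) (hBG : ∀ g x y, B (ρ g x) (ρ g y) = B x y)
    (hB : B.IsAlt) : B = 0 := by
  obtain ⟨c, hc⟩ := exists_eq_smul_of_invariant ρ hωG hω hBG
  exact eq_zero_of_isAlt_of_eq_smul_isSymm h2 hωsymm hB hc

/-! ### Dimension two: trivial determinant is the symplectic type -/

/-- **A two-dimensional irreducible representation with trivial determinant admits no non-zero
invariant symmetric bilinear form.** Let `ρ : G → GL(V)` be irreducible, `dim_k V = 2`, `k`
algebraically closed of characteristic `≠ 2`, and `det ρ(g) = 1` for all `g`. Then every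
`G`-invariant symmetric bilinear form on `V` is `0`, i.e. `Sym² V^*` (`≅ Sym² V`, `V` being
self-dual as `V ≅ V^* ⊗ det`) has no `G`-invariants. Proof: in a basis `b`, the determinant form
`ω(x, y) = det_b(x, y) = x₀y₁ − x₁y₀` is alternating, non-degenerate and transforms by
`det ρ(g) = 1` (`Basis.det_comp`), so `eq_zero_of_isSymm_of_isAlt_invariant` applies
(`∧² V = det`, Fulton–Harris §B.1). Census reading (Goldfeld 1977 §5, p. 224): for such objects
`L(Sym², s)` has no pole at the edge of the critical strip, so Goldfeld's `ρ`-parameter is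
exactly `1`, never `< 1`. [cite: SerreLinearRepresentations1977, §13.2 Prop. 38–39]
[cite: Goldfeld1977, §5 (p. 224)] -/
theorem eq_zero_of_isSymm_invariant_of_det_eq_one [FiniteDimensional k V] [IsAlgClosed k]
    (h2 : (2 : k) ≠ 0) (ρ : Representation k G V) [ρ.IsIrreducible] (hV : finrank k V = 2)
    (hdet : ∀ g, LinearMap.det (ρ g) = 1) {B : LinearMap.BilinForm k V}
    (hBG : ∀ g x y, B (ρ g x) (ρ g y) = B x y) (hB : B.IsSymm) : B = 0 := by
  let b : Basis (Fin 2) k V := Module.finBasisOfFinrankEq k V hV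
  -- the determinant form in the basis `b`
  let ω : LinearMap.BilinForm k V :=
    (LinearMap.mul k k).compl₁₂ (b.coord 0) (b.coord 1) -
      (LinearMap.mul k k).compl₁₂ (b.coord 1) (b.coord 0)
  have hωapply : ∀ x y, ω x y = b.repr x 0 * b.repr y 1 - b.repr x 1 * b.repr y 0 := fun x y ↦ by
    simp only [ω, LinearMap.sub_apply, LinearMap.compl₁₂_apply, LinearMap.mul_apply',
      Basis.coord_apply]
  have hωdet : ∀ x y, ω x y = b.det ![x, y] := fun x y ↦ by
    rw [hωapply, Basis.det_apply, Matrix.det_fin_two]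
    simp only [Basis.toMatrix_apply, Matrix.cons_val_zero, Matrix.cons_val_one]
    ring
  have hωG : ∀ g x y, ω (ρ g x) (ρ g y) = ω x y := fun g x y ↦ by
    have hcomp : (ρ g : V → V) ∘ ![x, y] = ![ρ g x, ρ g y] := by
      ext i
      fin_cases i <;> rfl
    rw [hωdet, hωdet, ← hcomp, Basis.det_comp, hdet g, one_mul]
  have hωalt : ω.IsAlt := fun x ↦ by rw [hωapply]; ring
  have hrepr : ∀ i j : Fin 2, b.repr (b i) j = if j = i then 1 else 0 := fun i j ↦ by
    rw [Basis.repr_self, Finsupp.single_apply]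
    simp only [eq_comm]
  have hω : ω.Nondegenerate := by
    refine ⟨fun x hx ↦ b.ext_elem fun i ↦ ?_, fun y hy ↦ b.ext_elem fun i ↦ ?_⟩
    · have h0 := hx (b 1)
      have h1 := hx (b 0)
      rw [hωapply, hrepr, hrepr] at h0 h1
      simp only [Fin.isValue, one_ne_zero, ↓reduceIte, mul_one, mul_zero, sub_zero,
        zero_ne_one, zero_sub, neg_eq_zero] at h0 h1
      fin_cases i <;> simp [h0, h1]
    · have h0 := hy (b 0)
      have h1 := hy (b 1)
      rw [hωapply, hrepr, hrepr] at h0 h1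
      simp only [Fin.isValue, ↓reduceIte, one_mul, zero_ne_one, zero_mul, sub_zero,
        one_ne_zero, zero_sub, neg_eq_zero] at h0 h1
      fin_cases i <;> simp [h0, h1]
  exact eq_zero_of_isSymm_of_isAlt_invariant h2 ρ hωG hω hωalt hBG hB

end Literature.RepresentationTheory
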